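import Summits.KontsevichZagierPeriods.KontsevichZagierPeriods.Theorems.K2SymbolChainsJensenIsScissorsRadial
import Summits.KontsevichZagierPeriods.KontsevichZagierPeriods.Theorems.K2SymbolChainsJensenIsScissorsDoublingB

/-!
# Jensen is scissors — the three cases `|α| < 1`, `|α| = 1`, `|α| > 1` for a real centre

Support file for item stmt-KontsevichZagierPeriods-5204 (`JensenIsScissors`, route
KontsevichZagierPeriods/K2SymbolChains). With `L(ρ)` the signed unfolding of
`h(x)/(1 + s²) · log W_{ρ(x)}(s)` over `B × ℝ` (`W_ρ(s) = ((1 − ρ)² + (1 + ρ)² s²)/(1 + s²) =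
|e^{iφ} − ρ|²`) and `S` any subgroup containing the three scissors move sets:
* `0 < ρ < 1`: `[L(ρ)] ∈ S` — doubling `2[L(ρ)] ~ [L(ρ²)]` and radial constancy
  `[L(ρ)] ~ [L(ρ²)]` give `[L(ρ)] = (2[L(ρ)] − [L(ρ²)]) − ([L(ρ)] − [L(ρ²)])` (Jensen inside the
  disc: `∫ log|e^{iφ} − ρ| dφ = 0`, with NO division by `2` and no limit);
* `ρ = 1`: `[L(1)] ∈ S` — doubling alone, `W_{1²} = W_1` (`∫ log|e^{iφ} − 1| dφ = 0`, Clausen);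
* `ρ > 1`: `[L(ρ)] − [L⁺(ρ²)] ∈ S`, `L⁺(ρ²)` the unfolding of `h/(1 + s²) · log ρ²` — the signed
  product rule for `W_ρ = ρ² · W_{1/ρ}` and the first case for `1/ρ` (Jensen outside:
  `∫ log|e^{iφ} − ρ| dφ = 2π log ρ`).
[Jensen 1899; Kontsevich–Zagier 2001, §1.2, rules 1)–2)] [folklore]
-/

noncomputable section

open MeasureTheory Set
open Literature.NumberTheory.Transcendental Literature.ModelTheory.ExponentialFields

namespace Summit.KontsevichZagierPeriods.K2SymbolChains.JensenIsScissorsProof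

open Literature.NumberTheory.Transcendental.KZ

variable {n : ℕ} {S : AddSubgroup FormalRep}

/-- Signed unfolding domains only depend on the values of the level function on the base.
[folklore] -/
theorem logUnfoldDomain_congr {m : ℕ} {T : Set (Fin m → ℝ)} {f g : (Fin m → ℝ) → ℝ}
    (h : ∀ b ∈ T, f b = g b) : logUnfoldDomain T f = logUnfoldDomain T g := by
  ext z
  simp only [logUnfoldDomain, mem_setOf_eq]
  constructor
  · rintro ⟨hb, hz⟩; rw [h _ hb] at hz; exact ⟨hb, hz⟩
  · rintro ⟨hb, hz⟩; rw [← h _ hb] at hz; exact ⟨hb, hz⟩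

/-- **Jensen inside the disc**: `[L(ρ)] ∈ S` for `0 < ρ < 1`. [Jensen 1899; Kontsevich–Zagier 2001,
§1.2] [folklore] -/
theorem jensen_inside (hS : domainAddRel ∪ integrandAddRel ∪ changeOfVariablesRel ⊆ S)
    {B : Set (Fin n → ℝ)} {h ρ : (Fin n → ℝ) → ℝ}
    (hB : IsSemialgebraic ℚ B) (hh : IsSemialgebraicFunOn ℚ B h) (hρs : IsSemialgebraicFunOn ℚ B ρ)
    (hρ0 : ∀ x ∈ B, 0 < ρ x) (hρ1 : ∀ x ∈ B, ρ x < 1) (hρd : ∀ x ∈ B, DifferentiableAt ℝ ρ x)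
    (hhi : IntegrableOn h B) (hhlog : IntegrableOn (fun x => h x * Real.log (ρ x)) B)
    (R : IntegralRep (n + 1 + 1))
    (hRd : R.domain = logUnfoldDomain {b : Fin (n + 1) → ℝ | Fin.init b ∈ B}
      (fun b => ((1 - ρ (Fin.init b)) ^ 2 + (1 + ρ (Fin.init b)) ^ 2 * b (Fin.last n) ^ 2) /
        (1 + b (Fin.last n) ^ 2)))
    (hRi : EqOn R.integrand (logUnfoldIntegrand fun b => h (Fin.init b) / (1 + b (Fin.last n) ^ 2)) R.domain) :
    of R ∈ S := by
  obtain ⟨R₂, hR₂d, hR₂i, e1⟩ := doubling_step hS hB hh hρs (fun x hx => (hρ0 x hx).le) hρd hhi R hRd hRi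
  have e2 := radial_step hS hB hh hρs hρ0 hρ1 hρd hhi hhlog R R₂ hRd hRi hR₂d (by rw [hR₂i]; exact fun _ _ => rfl)
  have : of R = (2 • of R - of R₂) - (of R - of R₂) := by abel
  rw [this]
  exact S.sub_mem e1 e2

/-- **Jensen on the circle**: `[L(ρ)] ∈ S` when `ρ = 1` on the base (doubling alone).
[Kontsevich–Zagier 2001, §1.2] [folklore] -/
theorem jensen_circle (hS : domainAddRel ∪ integrandAddRel ∪ changeOfVariablesRel ⊆ S)
    {B : Set (Fin n → ℝ)} {h ρ : (Fin n → ℝ) → ℝ}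
    (hB : IsSemialgebraic ℚ B) (hh : IsSemialgebraicFunOn ℚ B h) (hρs : IsSemialgebraicFunOn ℚ B ρ)
    (hρ1 : ∀ x ∈ B, ρ x = 1) (hρd : ∀ x ∈ B, DifferentiableAt ℝ ρ x) (hhi : IntegrableOn h B)
    (R : IntegralRep (n + 1 + 1))
    (hRd : R.domain = logUnfoldDomain {b : Fin (n + 1) → ℝ | Fin.init b ∈ B}
      (fun b => ((1 - ρ (Fin.init b)) ^ 2 + (1 + ρ (Fin.init b)) ^ 2 * b (Fin.last n) ^ 2) /
        (1 + b (Fin.last n) ^ 2)))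
    (hRi : EqOn R.integrand (logUnfoldIntegrand fun b => h (Fin.init b) / (1 + b (Fin.last n) ^ 2)) R.domain) :
    of R ∈ S := by
  obtain ⟨R₂, hR₂d, hR₂i, e1⟩ := doubling_step hS hB hh hρs (fun x hx => by rw [hρ1 x hx]; norm_num) hρd hhi R hRd hRi
  have e2 : of R₂ - of R ∈ S := by
    refine of_sub_of_mem_of_eqOn hS ?_ (fun z hz => ?_)
    · rw [hRd, hR₂d]
      refine logUnfoldDomain_congr fun b hb => ?_
      have hb' : Fin.init b ∈ B := hb
      simp only [hρ1 _ hb', one_pow]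
    · rw [hR₂i, hRi]
      rw [hRd, ← show R₂.domain = _ from hR₂d.trans (logUnfoldDomain_congr fun b hb => by
        have hb' : Fin.init b ∈ B := hb
        simp only [hρ1 _ hb', one_pow])]
      exact hz
  have : of R = (2 • of R - of R₂) + (of R₂ - of R) := by abel
  rw [this]
  exact S.add_mem e1 e2

/-- `W_ρ = ρ² · W_{1/ρ}`. [folklore] -/
theorem W_eq_sq_mul_W_inv {ρ : ℝ} (hρ : ρ ≠ 0) (s : ℝ) :
    ((1 - ρ) ^ 2 + (1 + ρ) ^ 2 * s ^ 2) / (1 + s ^ 2) =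
      ρ ^ 2 * (((1 - ρ⁻¹) ^ 2 + (1 + ρ⁻¹) ^ 2 * s ^ 2) / (1 + s ^ 2)) := by
  have hs : (1 + s ^ 2) ≠ 0 := by positivity
  field_simp
  ring

/-- **Jensen outside the disc**: `[L(ρ)] − [L⁺(ρ²)] ∈ S` for `ρ > 1`, where `L⁺(ρ²)` is the
unfolding of `h/(1 + s²) · log ρ²` (signed product rule for `W_ρ = ρ² · W_{1/ρ}` and Jensen inside for
`1/ρ`). [Jensen 1899; Kontsevich–Zagier 2001, §1.2] [folklore] -/
theorem jensen_outside (hS : domainAddRel ∪ integrandAddRel ∪ changeOfVariablesRel ⊆ S)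
    {B : Set (Fin n → ℝ)} {h ρ : (Fin n → ℝ) → ℝ}
    (hB : IsSemialgebraic ℚ B) (hh : IsSemialgebraicFunOn ℚ B h) (hρs : IsSemialgebraicFunOn ℚ B ρ)
    (hρ1 : ∀ x ∈ B, 1 < ρ x) (hρd : ∀ x ∈ B, DifferentiableAt ℝ ρ x)
    (hhi : IntegrableOn h B) (hhlog : IntegrableOn (fun x => h x * Real.log (ρ x)) B)
    (R R' : IntegralRep (n + 1 + 1))
    (hRd : R.domain = logUnfoldDomain {b : Fin (n + 1) → ℝ | Fin.init b ∈ B}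
      (fun b => ((1 - ρ (Fin.init b)) ^ 2 + (1 + ρ (Fin.init b)) ^ 2 * b (Fin.last n) ^ 2) /
        (1 + b (Fin.last n) ^ 2)))
    (hRi : EqOn R.integrand (logUnfoldIntegrand fun b => h (Fin.init b) / (1 + b (Fin.last n) ^ 2)) R.domain)
    (hR'd : R'.domain = logUnfoldDomain {b : Fin (n + 1) → ℝ | Fin.init b ∈ B} (fun b => ρ (Fin.init b) ^ 2))
    (hR'i : EqOn R'.integrand (logUnfoldIntegrand fun b => h (Fin.init b) / (1 + b (Fin.last n) ^ 2)) R'.domain) :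
    of R - of R' ∈ S := by
  -- notation
  set T : Set (Fin (n + 1) → ℝ) := {b | Fin.init b ∈ B} with hT_def
  set G : (Fin (n + 1) → ℝ) → ℝ := fun b => h (Fin.init b) / (1 + b (Fin.last n) ^ 2) with hG_def
  set W : (Fin (n + 1) → ℝ) → ℝ := fun b =>
    ((1 - ρ (Fin.init b)) ^ 2 + (1 + ρ (Fin.init b)) ^ 2 * b (Fin.last n) ^ 2) / (1 + b (Fin.last n) ^ 2)
    with hW_def
  set ρ' : (Fin n → ℝ) → ℝ := fun x => (ρ x)⁻¹ with hρ'_def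
  set Wi : (Fin (n + 1) → ℝ) → ℝ := fun b =>
    ((1 - ρ' (Fin.init b)) ^ 2 + (1 + ρ' (Fin.init b)) ^ 2 * b (Fin.last n) ^ 2) / (1 + b (Fin.last n) ^ 2)
    with hWi_def
  set V₁ : (Fin (n + 1) → ℝ) → ℝ := fun b => ρ (Fin.init b) ^ 2 with hV₁_def
  have hρ0 : ∀ x ∈ B, 0 < ρ x := fun x hx => one_pos.trans (hρ1 x hx)
  have hρ'0 : ∀ x ∈ B, 0 < ρ' x := fun x hx => inv_pos.2 (hρ0 x hx)
  have hρ'1 : ∀ x ∈ B, ρ' x < 1 := fun x hx => inv_lt_one_of_one_lt₀ (hρ1 x hx)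
  have hρ's : IsSemialgebraicFunOn ℚ B ρ' := hρs.inv fun x hx => (hρ0 x hx).ne'
  have hρ'd : ∀ x ∈ B, DifferentiableAt ℝ ρ' x := fun x hx => (hρd x hx).inv (hρ0 x hx).ne'
  have hhlog' : IntegrableOn (fun x => h x * Real.log (ρ' x)) B := by
    refine hhlog.neg.congr_fun (fun x _ => ?_) (IsSemialgebraic.measurableSet_holds hB)
    simp only [hρ'_def, Real.log_inv, Pi.neg_apply]; ring
  -- semialgebraicity and friends on `T`
  have hT : IsSemialgebraic ℚ T := isSemialgebraic_cyl hB
  have hGT : IsSemialgebraicFunOn ℚ T G := isSemialgebraicFunOn_weight hh hT subset_rfl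
  have hWT : IsSemialgebraicFunOn ℚ T W := isSemialgebraicFunOn_Wreal hρs hT subset_rfl
  have hWiT : IsSemialgebraicFunOn ℚ T Wi := isSemialgebraicFunOn_Wreal hρ's hT subset_rfl
  have hV₁T : IsSemialgebraicFunOn ℚ T V₁ :=
    ((IsSemialgebraicFunOn.mul_holds hρs hρs).comp_init.mono subset_rfl hT).congr fun b _ => by
      simp [hV₁_def, sq]
  have hWpos : ∀ b ∈ T, 0 < W b := fun b hb => by
    have h1 : (1 - ρ (Fin.init b)) ≠ 0 := by have := hρ1 _ hb; exact by linarith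
    have : 0 < (1 - ρ (Fin.init b)) ^ 2 := by positivity
    simp only [hW_def]; positivity
  have hWipos : ∀ b ∈ T, 0 < Wi b := fun b hb => by
    have h1 : (1 - ρ' (Fin.init b)) ≠ 0 := by have := hρ'1 _ hb; exact by linarith
    have : 0 < (1 - ρ' (Fin.init b)) ^ 2 := by positivity
    simp only [hWi_def]; positivity
  have hV₁pos : ∀ b ∈ T, 0 < V₁ b := fun b hb => by have := hρ0 _ hb; simp only [hV₁_def]; positivity
  have hWVW : ∀ b ∈ T, W b = V₁ b * Wi b := fun b hb => by
    simp only [hW_def, hV₁_def, hWi_def, hρ'_def]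
    exact W_eq_sq_mul_W_inv (hρ0 _ hb).ne' _
  -- integrability on `T`
  have hGi : IntegrableOn G T := by
    have := integrableOn_cyl_mul (B := B) (f := h) (g := fun s : ℝ => (1 + s ^ 2)⁻¹) hhi integrable_inv_one_add_sq
    refine this.congr_fun (fun b _ => ?_) (IsSemialgebraic.measurableSet_holds hT)
    simp only [hG_def, div_eq_mul_inv]
  have hGlogW : IntegrableOn (fun b => G b * Real.log (W b)) T :=
    integrableOn_mul_log_of_logUnfold hT hGT hWT hWpos
      (by rw [← hRd]; exact R.integrableOn.congr_fun hRi (IntegralRep.measurableSet_domain_holds R))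
  have hGlogV₁ : IntegrableOn (fun b => G b * Real.log (V₁ b)) T := by
    have := integrableOn_cyl_mul (B := B) (f := fun x => h x * Real.log (ρ x)) (g := fun s : ℝ => (1 + s ^ 2)⁻¹)
      hhlog integrable_inv_one_add_sq
    have h2 : IntegrableOn (fun b : Fin (n + 1) → ℝ => 2 * (h (Fin.init b) * Real.log (ρ (Fin.init b)) *
        (1 + b (Fin.last n) ^ 2)⁻¹)) T := this.const_mul 2
    refine h2.congr_fun (fun b _ => ?_) (IsSemialgebraic.measurableSet_holds hT)
    simp only [hG_def, hV₁_def, Real.log_pow, Nat.cast_ofNat]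
    ring
  have hGlogWi : IntegrableOn (fun b => G b * Real.log (Wi b)) T := by
    refine integrableOn_mul_log_of_bound (V₁ := W) (V₂ := V₁) hT hGT hWiT (fun b hb => ?_) hGi hGlogW hGlogV₁
    have hlog : Real.log (Wi b) = Real.log (W b) - Real.log (V₁ b) := by
      rw [hWVW b hb, Real.log_mul (hV₁pos b hb).ne' (hWipos b hb).ne']; ring
    rw [hlog]
    have := abs_sub (Real.log (W b)) (Real.log (V₁ b))
    have : 0 ≤ Real.log 2 := Real.log_nonneg (by norm_num)
    linarith
  -- the representations of the product rule
  set R₁₂ : IntegralRep (n + 1 + 1) :=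
    { domain := logUnfoldDomain T (fun b => V₁ b * Wi b)
      integrand := logUnfoldIntegrand G
      isSemialgebraic_domain := isSemialgebraic_logUnfoldDomain (IsSemialgebraicFunOn.mul_holds hV₁T hWiT)
      isSemialgebraicFunOn_integrand := isSemialgebraicFunOn_logUnfoldIntegrand hGT
        (IsSemialgebraicFunOn.mul_holds hV₁T hWiT) fun b hb => (mul_pos (hV₁pos b hb) (hWipos b hb)).le
      integrableOn := by
        rw [← logUnfoldDomain_congr hWVW, ← hRd]
        exact R.integrableOn.congr_fun hRi (IntegralRep.measurableSet_domain_holds R) } with hR₁₂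
  have e0 : of R - of R₁₂ ∈ S :=
    of_sub_of_mem_of_eqOn hS (by rw [hRd]; exact (logUnfoldDomain_congr hWVW).symm) hRi
  set R₂ : IntegralRep (n + 1 + 1) := logUnfoldRep T Wi G hT hGT hWiT (fun b hb => (hWipos b hb).le)
    (by
      rw [show {b | b ∈ T ∧ Wi b = 0} = (∅ : Set (Fin (n + 1) → ℝ)) by
        ext b; simp only [mem_setOf_eq, mem_empty_iff_false, iff_false, not_and]
        exact fun hb h0 => (hWipos b hb).ne' h0]
      exact measure_empty) hGlogWi with hR₂
  have esp : of R₁₂ - of R' - of R₂ ∈ S :=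
    of_logUnfold_prod_sub_sub_mem hS hT hGT hV₁T hWiT hV₁pos hWipos
      (fun b hb => by
        have hl : DifferentiableAt ℝ (fun b' : Fin (n + 1) → ℝ => ρ (Fin.init b')) b :=
          (hρd _ hb).comp b (ContinuousLinearMap.pi fun j => ContinuousLinearMap.proj (R := ℝ)
            (φ := fun _ : Fin (n + 1) => ℝ) (Fin.castSucc j)).differentiableAt
        exact hl.pow 2)
      (fun b hb => by
        have := differentiableAt_Wgen (n := n) (b := b) (hρ'd _ hb) 1 (-1) 1 1
        refine this.congr_of_eventuallyEq (Filter.Eventually.of_forall fun b => ?_)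
        simp only [hWi_def]; ring_nf)
      hGi hGlogV₁ hGlogWi R₁₂ R' R₂ rfl (fun _ _ => rfl) hR'd hR'i rfl (fun _ _ => rfl)
  have ein : of R₂ ∈ S := jensen_inside hS hB hh hρ's hρ'0 hρ'1 hρ'd hhi hhlog' R₂ rfl (fun _ _ => rfl)
  have : of R - of R' = (of R - of R₁₂) + (of R₁₂ - of R' - of R₂) + of R₂ := by abel
  rw [this]
  exact S.add_mem (S.add_mem e0 esp) ein

end Summit.KontsevichZagierPeriods.K2SymbolChains.JensenIsScissorsProof
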